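import Mathlib.MeasureTheory.Integral.Prod
import Mathlib.MeasureTheory.Constructions.Pi
import Mathlib.MeasureTheory.Integral.IntervalIntegral.Basic
import Mathlib.MeasureTheory.Integral.Bochner.Set
import Mathlib.MeasureTheory.Measure.Haar.OfBasis
import Mathlib.Analysis.SpecialFunctions.Integrals.Basic
import HarnessLib

/-!
# Fubini bookkeeping on unit cubes: peeling off a coordinate, swapping, and the scaled square

Topic `Literature/Geometry/Manifold` (support for the integration of forms over simplices through
the collapsed cube, `…Manifold.SimplexIntegral`, and for the shuffle Fubini identity of
`…Manifold.ShuffleFubini`). Elementary identities of Bochner integrals of CONTINUOUS Banach-valued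
functions over unit cubes `[0,1]ⁿ ⊆ ℝⁿ = Fin n → ℝ`:

* `setIntegral_unitCube_succ` — peel off the first coordinate:
  `∫_{[0,1]ⁿ⁺¹} f = ∫_{a ∈ [0,1]} ∫_{t ∈ [0,1]ⁿ} f(a, t)` (`Fin.cons`; the measurable equivalence
  `MeasurableEquiv.piFinSuccAbove` is volume preserving);
* `setIntegral_unitCube_zero` — `∫_{[0,1]⁰} f = f 0`;
* `setIntegral_setIntegral_swap_of_continuous` — swap two iterated integrals over compact sets;
* `setIntegral_unitSquare_split` — **the scaled square**: for continuous `G` on `ℝ²`,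
  `∫₀¹∫₀¹ G(a,b) db da = ∫₀¹ a ∫₀¹ G(a, aσ) dσ da + ∫₀¹ b ∫₀¹ G(bσ, b) dσ db`
  (split the square along the diagonal and rescale the short variable; the one-variable
  substitution `intervalIntegral.smul_integral_comp_mul_left`). This is the analytic content of
  the cone recursion of the shuffle simplices: a first right-step corresponds to the triangle
  `{b ≤ a}`, a first up-step to `{a ≤ b}`.

Everything is proved; no named facts; Mathlib-only imports.
-/

noncomputable section

open Set MeasureTheory intervalIntegral

namespace Literature.Geometry.Manifold

variable {F : Type*} [NormedAddCommGroup F] [NormedSpace ℝ F] {n : ℕ}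

/-! ### Membership in cubes -/

/-- `(a, t) ∈ [0,1]ⁿ⁺¹ ↔ a ∈ [0,1] ∧ t ∈ [0,1]ⁿ`. [folklore] -/
theorem cons_mem_Icc_iff {a : ℝ} {t : Fin n → ℝ} :
    (Fin.cons a t : Fin (n + 1) → ℝ) ∈ Icc (0 : Fin (n + 1) → ℝ) 1 ↔ a ∈ Icc (0 : ℝ) 1 ∧ t ∈ Icc (0 : Fin n → ℝ) 1 := by
  simp only [mem_Icc, Pi.le_def, Fin.forall_fin_succ, Fin.cons_zero, Fin.cons_succ, Pi.zero_apply, Pi.one_apply]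
  tauto

/-- The unit cube is compact. [folklore] -/
theorem isCompact_unitCube' (n : ℕ) : IsCompact (Icc (0 : Fin n → ℝ) 1) := isCompact_Icc

/-! ### Peeling off the first coordinate -/

/-- The measurable equivalence `ℝ × ℝⁿ ≃ ℝⁿ⁺¹`, `(a, t) ↦ (a, t₀, …, t_{n-1})`. [folklore] -/
def consEquiv (n : ℕ) : ℝ × (Fin n → ℝ) ≃ᵐ (Fin (n + 1) → ℝ) :=
  (MeasurableEquiv.piFinSuccAbove (fun _ : Fin (n + 1) ↦ ℝ) 0).symm

/-- `consEquiv` is `Fin.cons`. [folklore] -/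
theorem consEquiv_apply (n : ℕ) (z : ℝ × (Fin n → ℝ)) : consEquiv n z = Fin.cons z.1 z.2 := by
  change (Fin.insertNthEquiv (fun _ : Fin (n + 1) ↦ ℝ) 0) z = _
  simp [Fin.insertNthEquiv, Fin.insertNth_zero']

/-- `consEquiv` preserves Lebesgue measure. [folklore] -/
theorem measurePreserving_consEquiv (n : ℕ) : MeasurePreserving (consEquiv n) volume volume :=
  (volume_preserving_piFinSuccAbove (fun _ : Fin (n + 1) ↦ ℝ) 0).symm _

/-- `(a, t) ↦ (a, t₀, …)` is continuous. [folklore] -/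
theorem continuous_cons' (n : ℕ) : Continuous fun z : ℝ × (Fin n → ℝ) ↦ (Fin.cons z.1 z.2 : Fin (n + 1) → ℝ) := by
  refine continuous_pi fun i ↦ ?_
  refine Fin.cases ?_ (fun j ↦ ?_) i
  · simp only [Fin.cons_zero]
    exact continuous_fst
  · simp only [Fin.cons_succ]
    exact (continuous_apply j).comp continuous_snd

/-- **Peeling off the first coordinate of a cube integral**: for `f` continuous,
`∫_{[0,1]ⁿ⁺¹} f = ∫_{a ∈ [0,1]} ∫_{t ∈ [0,1]ⁿ} f (a, t)`. [folklore] -/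
theorem setIntegral_unitCube_succ [CompleteSpace F] (f : (Fin (n + 1) → ℝ) → F) (hf : Continuous f) :
    ∫ t in Icc (0 : Fin (n + 1) → ℝ) 1, f t =
      ∫ a in Icc (0 : ℝ) 1, ∫ t in Icc (0 : Fin n → ℝ) 1, f (Fin.cons a t) := by
  have he := measurePreserving_consEquiv n
  have hemb := (consEquiv n).measurableEmbedding
  have hpre : consEquiv n ⁻¹' Icc (0 : Fin (n + 1) → ℝ) 1 = Icc (0 : ℝ) 1 ×ˢ Icc (0 : Fin n → ℝ) 1 := by
    ext ⟨a, t⟩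
    rw [mem_preimage, consEquiv_apply, cons_mem_Icc_iff, mem_prod]
  have hcont : Continuous fun z : ℝ × (Fin n → ℝ) ↦ f (consEquiv n z) := by
    have : (fun z : ℝ × (Fin n → ℝ) ↦ f (consEquiv n z)) = f ∘ fun z ↦ Fin.cons z.1 z.2 := by
      funext z; rw [Function.comp_apply, consEquiv_apply]
    rw [this]
    exact hf.comp (continuous_cons' n)
  rw [← he.setIntegral_preimage_emb hemb f, hpre, Measure.volume_eq_prod, setIntegral_prod]
  · simp only [consEquiv_apply]
  · exact hcont.continuousOn.integrableOn_compact (isCompact_Icc.prod isCompact_Icc)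

/-- **The cube integral in dimension `0` is evaluation.** [folklore] -/
theorem setIntegral_unitCube_zero [CompleteSpace F] (f : (Fin 0 → ℝ) → F) : ∫ t in Icc (0 : Fin 0 → ℝ) 1, f t = f 0 := by
  have hvol : (volume : Measure (Fin 0 → ℝ)) = Measure.dirac 0 := by
    rw [MeasureTheory.volume_pi, Measure.pi_of_empty]
    congr 1
    exact Subsingleton.elim _ _
  classical
  rw [hvol, setIntegral_dirac, if_pos (by simp)]

/-! ### Swapping two iterated integrals over compact sets -/

/-- **Fubini swap for continuous integrands on compact sets**:
`∫_{x ∈ K} ∫_{y ∈ L} f(x,y) = ∫_{y ∈ L} ∫_{x ∈ K} f(x,y)`. [folklore] -/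
theorem setIntegral_setIntegral_swap_of_continuous {X Y : Type*} [MeasurableSpace X] [TopologicalSpace X]
    [MeasurableSpace Y] [TopologicalSpace Y] [OpensMeasurableSpace (X × Y)] [T2Space (X × Y)]
    {μ : Measure X} {ν : Measure Y} [SigmaFinite μ] [SigmaFinite ν] [IsFiniteMeasureOnCompacts (μ.prod ν)]
    [SecondCountableTopologyEither (X × Y) F]
    [CompleteSpace F] (f : X → Y → F) (hf : Continuous (Function.uncurry f))
    {K : Set X} {L : Set Y} (hK : IsCompact K) (hL : IsCompact L) :
    ∫ x in K, ∫ y in L, f x y ∂ν ∂μ = ∫ y in L, ∫ x in K, f x y ∂μ ∂ν := by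
  have hint : Integrable (Function.uncurry f) ((μ.restrict K).prod (ν.restrict L)) := by
    rw [Measure.prod_restrict]
    exact hf.continuousOn.integrableOn_compact (hK.prod hL)
  exact integral_integral_swap hint

/-! ### The scaled square -/

/-- One-variable scaling on `[0, a]`: `∫_{b ∈ [0,a]} g(b) db = a • ∫_{σ ∈ [0,1]} g(aσ) dσ` (`a ≥ 0`). [folklore] -/
theorem setIntegral_Icc_eq_smul_setIntegral_comp_mul (g : ℝ → F) {a : ℝ} (ha : 0 ≤ a) :
    ∫ b in Icc 0 a, g b = a • ∫ σ in Icc (0 : ℝ) 1, g (a * σ) := by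
  rw [integral_Icc_eq_integral_Ioc, integral_Icc_eq_integral_Ioc, ← intervalIntegral.integral_of_le ha,
    ← intervalIntegral.integral_of_le zero_le_one, intervalIntegral.smul_integral_comp_mul_left, mul_zero, mul_one]

/-- Splitting the inner integral at the outer variable: for `a ∈ [0,1]`,
`∫_{b ∈ [0,1]} g = ∫_{b ∈ [0,a]} g + ∫_{b ∈ [0,1]} 1_{a < b} g`. [folklore] -/
theorem setIntegral_Icc_split (g : ℝ → F) (hg : IntegrableOn g (Icc (0 : ℝ) 1)) {a : ℝ} (ha : a ∈ Icc (0 : ℝ) 1) :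
    ∫ b in Icc (0 : ℝ) 1, g b = (∫ b in Icc 0 a, g b) + ∫ b in Icc (0 : ℝ) 1, (Ioi a).indicator g b := by
  rw [setIntegral_indicator measurableSet_Ioi]
  have hIoc : Icc (0 : ℝ) 1 ∩ Ioi a = Ioc a 1 := by
    ext b; simp only [mem_inter_iff, mem_Icc, mem_Ioi, mem_Ioc]; constructor
    · rintro ⟨⟨_, h1⟩, h2⟩; exact ⟨h2, h1⟩
    · rintro ⟨h1, h2⟩; exact ⟨⟨le_trans ha.1 h1.le, h2⟩, h1⟩
  rw [hIoc]
  have hunion : Icc 0 a ∪ Ioc a 1 = Icc (0 : ℝ) 1 := Icc_union_Ioc_eq_Icc ha.1 ha.2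
  have hdisj : Disjoint (Icc 0 a) (Ioc a 1) := by
    rw [Set.disjoint_left]; intro b hb hb'; exact (not_lt.mpr hb.2) hb'.1
  rw [← hunion, setIntegral_union hdisj measurableSet_Ioc (hg.mono_set (by rw [← hunion]; exact subset_union_left))
    (hg.mono_set (by rw [← hunion]; exact subset_union_right))]

/-- **The scaled square**: for `G` continuous on `ℝ²`,
`∫₀¹∫₀¹ G(a,b) db da = ∫₀¹ a ∫₀¹ G(a, aσ) dσ da + ∫₀¹ b ∫₀¹ G(bσ, b) dσ db`
(the triangles `{b ≤ a}` and `{a < b}`, each rescaled to the square). [folklore] -/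
theorem setIntegral_unitSquare_split [CompleteSpace F] (G : ℝ × ℝ → F) (hG : Continuous G) :
    ∫ a in Icc (0 : ℝ) 1, ∫ b in Icc (0 : ℝ) 1, G (a, b) =
      (∫ a in Icc (0 : ℝ) 1, a • ∫ σ in Icc (0 : ℝ) 1, G (a, a * σ)) +
        ∫ b in Icc (0 : ℝ) 1, b • ∫ σ in Icc (0 : ℝ) 1, G (b * σ, b) := by
  -- split the inner integral at `a`
  have hsplit : ∀ a ∈ Icc (0 : ℝ) 1, ∫ b in Icc (0 : ℝ) 1, G (a, b) =
      (a • ∫ σ in Icc (0 : ℝ) 1, G (a, a * σ)) + ∫ b in Icc (0 : ℝ) 1, (Ioi a).indicator (fun b ↦ G (a, b)) b := by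
    intro a ha
    have hg : IntegrableOn (fun b ↦ G (a, b)) (Icc (0 : ℝ) 1) :=
      (hG.comp (Continuous.prodMk_right a)).continuousOn.integrableOn_compact isCompact_Icc
    rw [setIntegral_Icc_split _ hg ha, setIntegral_Icc_eq_smul_setIntegral_comp_mul _ ha.1]
  rw [setIntegral_congr_fun measurableSet_Icc hsplit, MeasureTheory.integral_add]
  rotate_left
  · -- integrability of `a ↦ a • ∫ G(a, aσ) dσ`
    refine ContinuousOn.integrableOn_compact isCompact_Icc (Continuous.continuousOn ?_)
    refine continuous_id.smul ?_
    exact continuous_parametric_integral_of_continuous (by fun_prop) isCompact_Icc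
  · -- integrability of the indicator part: bounded measurable on a finite measure set
    have heq : (fun z : ℝ × ℝ ↦ (Ioi z.1).indicator (fun b ↦ G (z.1, b)) z.2) =
        {z : ℝ × ℝ | z.1 < z.2}.indicator G := by
      funext z; simp only [indicator, mem_Ioi, mem_setOf_eq, Prod.mk.eta]; split_ifs <;> rfl
    have hint : Integrable (fun z : ℝ × ℝ ↦ (Ioi z.1).indicator (fun b ↦ G (z.1, b)) z.2)
        ((volume.restrict (Icc (0 : ℝ) 1)).prod (volume.restrict (Icc (0 : ℝ) 1))) := by
      rw [Measure.prod_restrict, heq]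
      exact ((hG.continuousOn.integrableOn_compact (isCompact_Icc.prod isCompact_Icc)).indicator
        (measurableSet_lt measurable_fst measurable_snd))
    exact hint.integral_prod_left
  congr 1
  -- the indicator part: swap the order of integration and rescale
  have hmeasI : ∀ b : ℝ, MeasurableSet {a : ℝ | a < b} := fun b ↦ measurableSet_Iio
  calc ∫ a in Icc (0 : ℝ) 1, ∫ b in Icc (0 : ℝ) 1, (Ioi a).indicator (fun b ↦ G (a, b)) b
      = ∫ a in Icc (0 : ℝ) 1, ∫ b in Icc (0 : ℝ) 1, {z : ℝ × ℝ | z.1 < z.2}.indicator G (a, b) := by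
        refine setIntegral_congr_fun measurableSet_Icc fun a _ ↦ setIntegral_congr_fun measurableSet_Icc fun b _ ↦ ?_
        simp only [indicator, mem_Ioi, mem_setOf_eq]
        rfl
    _ = ∫ b in Icc (0 : ℝ) 1, ∫ a in Icc (0 : ℝ) 1, {z : ℝ × ℝ | z.1 < z.2}.indicator G (a, b) := by
        have hint : Integrable (Function.uncurry fun a b ↦ {z : ℝ × ℝ | z.1 < z.2}.indicator G (a, b))
            ((volume.restrict (Icc (0 : ℝ) 1)).prod (volume.restrict (Icc (0 : ℝ) 1))) := by
          rw [Measure.prod_restrict]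
          have : Function.uncurry (fun a b ↦ {z : ℝ × ℝ | z.1 < z.2}.indicator G (a, b)) =
              {z : ℝ × ℝ | z.1 < z.2}.indicator G := by funext ⟨a, b⟩; rfl
          rw [this]
          exact (hG.continuousOn.integrableOn_compact (isCompact_Icc.prod isCompact_Icc)).indicator
            (measurableSet_lt measurable_fst measurable_snd)
        exact integral_integral_swap hint
    _ = ∫ b in Icc (0 : ℝ) 1, ∫ a in Icc 0 b, G (a, b) := by
        refine setIntegral_congr_fun measurableSet_Icc fun b hb ↦ ?_
        have : (fun a ↦ {z : ℝ × ℝ | z.1 < z.2}.indicator G (a, b)) = (Iio b).indicator fun a ↦ G (a, b) := by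
          funext a; simp only [indicator, mem_setOf_eq, mem_Iio]
          rfl
        rw [this, setIntegral_indicator measurableSet_Iio]
        have hI : Icc (0 : ℝ) 1 ∩ Iio b = Ico 0 b := by
          ext a; simp only [mem_inter_iff, mem_Icc, mem_Iio, mem_Ico]; constructor
          · rintro ⟨⟨h0, _⟩, h1⟩; exact ⟨h0, h1⟩
          · rintro ⟨h0, h1⟩; exact ⟨⟨h0, le_trans h1.le hb.2⟩, h1⟩
        rw [hI, integral_Icc_eq_integral_Ioc, integral_Ico_eq_integral_Ioc]
    _ = ∫ b in Icc (0 : ℝ) 1, b • ∫ σ in Icc (0 : ℝ) 1, G (b * σ, b) := by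
        refine setIntegral_congr_fun measurableSet_Icc fun b hb ↦ ?_
        exact setIntegral_Icc_eq_smul_setIntegral_comp_mul (fun a ↦ G (a, b)) hb.1

end Literature.Geometry.Manifold
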